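import Literature.Topology.Euclidean.LatticeCubeComplex
import HarnessLib

/-!
# Faces of lattice cubes: the open face through a point, the boundary of a face, corners

Topic `Literature/Topology/Euclidean`, continuing `LatticeCubeComplex.lean` (faces
`LatticeCube.Face N` of the cubical lattice `h ℤᴺ ⊆ ℝᴺ`, their closed carriers, relative
interiors, affine characteristic maps `param` / `coord`, boundary faces `bdFace`, finite cube
complexes `LatticeCube.complex 𝒬 h` and their CW structure). Elementary combinatorial geometry
needed for *skeletal inductions* over a cube complex (define a map face by face, by increasing
dimension, extending over each face from its boundary — Hatcher, *Algebraic Topology* (2002),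
proof of Thm. A.7, p. 527), all PROVED, [folklore]:

* `Face.relintFace G h y`: the face of `G` in whose relative interior the point `y ∈ G` lies
  (freeze the free coordinates of `y` sitting at an end of their interval);
  `mem_relint_relintFace`, `relintFace_S_subset`, `relintFace_isFaceOf`,
  `card_relintFace_S_lt` (a boundary point lies in the relative interior of a face of smaller
  dimension); uniqueness is `Face.eq_of_mem_relint` of the previous file.
* The boundary of a face: `exists_mem_carrier_bdFace` (a point of `G` off `relint G` lies in a
  boundary face `G.bdFace i up`, `i ∈ G.S`), `carrier_bdFace_subset`,
  `not_mem_relint_of_mem_carrier_bdFace`; in the characteristic cube: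
  `norm_coord_eq_one_of_not_mem_relint`, `param_mem_relint_iff`.
* Corners: `Face.cornerPoint G h = (aᵢ h)ᵢ ∈ G`, `Face.corner G = ⟨G.a, ∅⟩` (a vertex, a face
  of every cube `G` is a face of), `carrier_eq_singleton_of_S_eq_empty` (a vertex is a point),
  `dist_cornerPoint_bdFace_le` (corners of `G` and of its boundary faces are `≤ h` apart);
  `exists_mem_relint_of_mem_complex` (every point of the complex is in the relative interior of a
  face of `𝒬`).

## References

* A. Hatcher, *Algebraic Topology*, CUP (2002), Appendix, proof of Thm. A.7 (p. 527) and
  pp. 519–521 (cubes as cells). [HatcherAT2002]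
-/

noncomputable section

open Set Metric Function

namespace Literature.Topology.Euclidean

namespace LatticeCube

namespace Face

variable {N : ℕ} {h : ℝ} (G : Face N)

/-! ### The face through a point -/

/-- The face of `G` in whose relative interior `y` lies: keep free exactly the free directions
of `G` in which `y` is strictly inside its interval, and move the corner up in the directions
where `y` sits at the upper end. [folklore] -/
def relintFace (h : ℝ) (y : Fin N → ℝ) : Face N := by
  classical
  exact ⟨fun i => if i ∈ G.S ∧ y i = ((G.a i : ℝ) + 1) * h then G.a i + 1 else G.a i,
    G.S.filter fun i => (G.a i : ℝ) * h < y i ∧ y i < ((G.a i : ℝ) + 1) * h⟩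

/-- The free directions of `relintFace` are free directions of `G`. [folklore] -/
theorem relintFace_S_subset (y : Fin N → ℝ) : (G.relintFace h y).S ⊆ G.S := by
  classical
  intro i hi
  simp only [relintFace, Finset.mem_filter] at hi
  exact hi.1

/-- Membership in the free directions of `relintFace`. [folklore] -/
theorem mem_relintFace_S {y : Fin N → ℝ} {i : Fin N} :
    i ∈ (G.relintFace h y).S ↔ i ∈ G.S ∧ (G.a i : ℝ) * h < y i ∧ y i < ((G.a i : ℝ) + 1) * h := by
  classical
  simp [relintFace]

/-- The corner of `relintFace` in a direction where `y` sits at the upper end. [folklore] -/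
theorem relintFace_a_of_eq {y : Fin N → ℝ} {i : Fin N} (hi : i ∈ G.S)
    (hy : y i = ((G.a i : ℝ) + 1) * h) : (G.relintFace h y).a i = G.a i + 1 := by
  classical
  simp [relintFace, hi, hy]

/-- The corner of `relintFace` in the other directions. [folklore] -/
theorem relintFace_a_of_ne {y : Fin N → ℝ} {i : Fin N} (hy : ¬ (i ∈ G.S ∧ y i = ((G.a i : ℝ) + 1) * h)) :
    (G.relintFace h y).a i = G.a i := by
  classical
  simp only [relintFace]
  rw [if_neg hy]

variable {G}

/-- **Every point of a closed face lies in the relative interior of `relintFace`.** [folklore] -/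
theorem mem_relint_relintFace {y : Fin N → ℝ} (hy : y ∈ G.carrier h) :
    y ∈ (G.relintFace h y).relint h := by
  intro i
  constructor
  · intro hi
    rw [mem_relintFace_S] at hi
    have hne : ¬ (i ∈ G.S ∧ y i = ((G.a i : ℝ) + 1) * h) := fun h' => by
      rw [h'.2] at hi; exact lt_irrefl _ hi.2.2
    rw [relintFace_a_of_ne G hne]
    exact hi.2
  · intro hi
    rw [mem_relintFace_S, not_and] at hi
    by_cases hiS : i ∈ G.S
    · have hb := (hy i).1 hiS
      have hns := hi hiS
      by_cases hup : y i = ((G.a i : ℝ) + 1) * h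
      · rw [relintFace_a_of_eq G hiS hup, hup]; push_cast; ring
      · have hlow : y i = (G.a i : ℝ) * h := by
          rcases hb.1.lt_or_eq with hlt | heq
          · exact absurd ⟨hlt, lt_of_le_of_ne hb.2 hup⟩ hns
          · exact heq.symm
        rw [relintFace_a_of_ne G (fun h' => hup h'.2), hlow]
    · rw [relintFace_a_of_ne G (fun h' => hiS h'.1)]
      exact (hy i).2 hiS

/-- `relintFace` of a face of the cube `b` is a face of the cube `b`. [folklore] -/
theorem relintFace_isFaceOf {b : Fin N → ℤ} (hG : G.IsFaceOf b) (y : Fin N → ℝ) :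
    (G.relintFace h y).IsFaceOf b := by
  intro i
  constructor
  · intro hi
    rw [mem_relintFace_S] at hi
    have hne : ¬ (i ∈ G.S ∧ y i = ((G.a i : ℝ) + 1) * h) := fun h' => by
      rw [h'.2] at hi; exact lt_irrefl _ hi.2.2
    rw [relintFace_a_of_ne G hne]
    exact (hG i).1 hi.1
  · intro _
    by_cases hiS : i ∈ G.S
    · have h0 : G.a i = b i := (hG i).1 hiS
      by_cases hup : y i = ((G.a i : ℝ) + 1) * h
      · right; rw [relintFace_a_of_eq G hiS hup, h0]
      · left; rw [relintFace_a_of_ne G (fun h' => hup h'.2), h0]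
    · rw [relintFace_a_of_ne G (fun h' => hiS h'.1)]
      exact (hG i).2 hiS

/-- If `y ∈ G` is not in the relative interior of `G`, its face `relintFace` has strictly fewer
free directions. [folklore] -/
theorem card_relintFace_S_lt {y : Fin N → ℝ} (hy : y ∈ G.carrier h)
    (hy' : y ∉ G.relint h) : (G.relintFace h y).S.card < G.S.card := by
  refine Finset.card_lt_card ⟨relintFace_S_subset G y, fun hsub => hy' ?_⟩
  have heq : (G.relintFace h y).S = G.S := Finset.Subset.antisymm (relintFace_S_subset G y) hsub
  -- then `relintFace h y = G`
  have hmem := mem_relint_relintFace hy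
  intro i
  constructor
  · intro hi
    have hi' : i ∈ (G.relintFace h y).S := heq ▸ hi
    have h1 := (hmem i).1 hi'
    rw [mem_relintFace_S] at hi'
    exact hi'.2
  · intro hi
    have hi' : i ∉ (G.relintFace h y).S := heq ▸ hi
    have h1 := (hmem i).2 hi'
    rwa [relintFace_a_of_ne G (fun h' => hi h'.1)] at h1

/-- `relintFace` has at most as many free directions as `G`. [folklore] -/
theorem card_relintFace_S_le (y : Fin N → ℝ) : (G.relintFace h y).S.card ≤ G.S.card :=
  Finset.card_le_card (relintFace_S_subset G y)

/-! ### The boundary of a face -/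

/-- A boundary face lies in the face (for `h ≥ 0`). [folklore] -/
theorem carrier_bdFace_subset (hh : 0 ≤ h) {i₀ : Fin N} (hi₀ : i₀ ∈ G.S) (up : Bool) :
    (G.bdFace i₀ up).carrier h ⊆ G.carrier h := by
  intro y hy i
  by_cases hii : i = i₀
  · subst hii
    have h1 := (hy i).2 (by rw [bdFace_S, Finset.mem_erase]; exact fun h' => h'.1 rfl)
    constructor
    · intro _
      cases up
      · rw [bdFace_a_self_false] at h1; rw [h1]; constructor <;> nlinarith
      · rw [bdFace_a_self_true] at h1; rw [h1]; push_cast; constructor <;> nlinarith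
    · intro hi; exact absurd hi₀ hi
  · have hS : i ∈ (G.bdFace i₀ up).S ↔ i ∈ G.S := by
      rw [bdFace_S, Finset.mem_erase]; exact ⟨fun h' => h'.2, fun h' => ⟨hii, h'⟩⟩
    constructor
    · intro hi
      have h1 := (hy i).1 (hS.2 hi)
      rwa [bdFace_a_of_ne G up hii] at h1
    · intro hi
      have h1 := (hy i).2 (fun h' => hi (hS.1 h'))
      rwa [bdFace_a_of_ne G up hii] at h1

/-- A point of a boundary face is not in the relative interior (for `h > 0`). [folklore] -/
theorem not_mem_relint_of_mem_carrier_bdFace {i₀ : Fin N} (hi₀ : i₀ ∈ G.S) (up : Bool)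
    {y : Fin N → ℝ} (hy : y ∈ (G.bdFace i₀ up).carrier h) : y ∉ G.relint h := by
  intro hy'
  have h1 := (hy i₀).2 (by rw [bdFace_S, Finset.mem_erase]; exact fun h' => h'.1 rfl)
  have h2 := (hy' i₀).1 hi₀
  cases up
  · rw [bdFace_a_self_false] at h1; rw [h1] at h2; exact lt_irrefl _ h2.1
  · rw [bdFace_a_self_true] at h1
    push_cast at h1
    rw [h1] at h2; exact lt_irrefl _ h2.2

/-- **A point of a face off its relative interior lies in a boundary face.** [folklore] -/
theorem exists_mem_carrier_bdFace {y : Fin N → ℝ} (hy : y ∈ G.carrier h) (hy' : y ∉ G.relint h) :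
    ∃ i₀ ∈ G.S, ∃ up : Bool, y ∈ (G.bdFace i₀ up).carrier h := by
  -- a free direction where the strict inequality fails
  obtain ⟨i₀, hi₀⟩ : ∃ i₀, ¬ ((i₀ ∈ G.S → (G.a i₀ : ℝ) * h < y i₀ ∧ y i₀ < ((G.a i₀ : ℝ) + 1) * h) ∧
      (i₀ ∉ G.S → y i₀ = (G.a i₀ : ℝ) * h)) := by
    by_contra hall
    push Not at hall
    exact hy' fun i => hall i
  have hi₀S : i₀ ∈ G.S := by
    by_contra hns
    exact hi₀ ⟨fun h' => absurd h' hns, fun _ => (hy i₀).2 hns⟩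
  have hb := (hy i₀).1 hi₀S
  have hns : ¬ ((G.a i₀ : ℝ) * h < y i₀ ∧ y i₀ < ((G.a i₀ : ℝ) + 1) * h) := fun h' =>
    hi₀ ⟨fun _ => h', fun h'' => absurd hi₀S h''⟩
  -- `y i₀` is an endpoint
  have hend : y i₀ = (G.a i₀ : ℝ) * h ∨ y i₀ = ((G.a i₀ : ℝ) + 1) * h := by
    rcases hb.1.lt_or_eq with hlt | heq
    · right
      rcases hb.2.lt_or_eq with hlt' | heq'
      · exact absurd ⟨hlt, hlt'⟩ hns
      · exact heq'
    · exact Or.inl heq.symm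
  have key : ∀ up : Bool, y i₀ = (if up then ((G.a i₀ : ℝ) + 1) * h else (G.a i₀ : ℝ) * h) →
      y ∈ (G.bdFace i₀ up).carrier h := by
    intro up hup i
    by_cases hii : i = i₀
    · subst hii
      constructor
      · intro hi
        rw [bdFace_S, Finset.mem_erase] at hi
        exact absurd rfl hi.1
      · intro _
        cases up
        · rw [bdFace_a_self_false]; simpa using hup
        · rw [bdFace_a_self_true]; push_cast; simpa using hup
    · rw [bdFace_a_of_ne G up hii, bdFace_S, Finset.mem_erase]
      constructor
      · intro hi; exact (hy i).1 hi.2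
      · intro hi
        rw [not_and] at hi
        exact (hy i).2 (hi hii)
  rcases hend with h0 | h1
  · exact ⟨i₀, hi₀S, false, key false (by simpa using h0)⟩
  · exact ⟨i₀, hi₀S, true, key true (by simpa using h1)⟩

/-- The carrier is the relative interior together with the boundary faces. [folklore] -/
theorem mem_carrier_iff_mem_relint_or (hh : 0 < h) {y : Fin N → ℝ} :
    y ∈ G.carrier h ↔ y ∈ G.relint h ∨ ∃ i₀ ∈ G.S, ∃ up : Bool, y ∈ (G.bdFace i₀ up).carrier h := by
  constructor
  · intro hy
    by_cases hy' : y ∈ G.relint h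
    · exact Or.inl hy'
    · exact Or.inr (exists_mem_carrier_bdFace hy hy')
  · rintro (hy | ⟨i₀, hi₀, up, hy⟩)
    · exact relint_subset_carrier hy
    · exact carrier_bdFace_subset hh.le hi₀ up hy

/-- In cube coordinates, a point of the face off the relative interior lies on the unit sphere.
[folklore] -/
theorem norm_coord_eq_one_of_not_mem_relint (hh : 0 < h) {k : ℕ} (hk : G.S.card = k)
    {y : Fin N → ℝ} (hy : y ∈ G.carrier h) (hy' : y ∉ G.relint h) : ‖G.coord h hk y‖ = 1 := by
  refine le_antisymm (mem_closedBall_zero_iff.1 (coord_mem_closedBall hh hy)) ?_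
  by_contra hlt
  rw [not_le] at hlt
  exact hy' (by
    have := param_mem_relint (F := G) (hk := hk) hh (mem_ball_zero_iff.2 hlt)
    rwa [param_coord hh hy] at this)

/-- `param y` lies in the relative interior iff `y` lies in the open cube (for `y` in the closed
cube). [folklore] -/
theorem param_mem_relint_iff (hh : 0 < h) {k : ℕ} (hk : G.S.card = k) {y : Fin k → ℝ}
    (hy : y ∈ closedBall (0 : Fin k → ℝ) 1) : G.param h hk y ∈ G.relint h ↔ y ∈ ball (0 : Fin k → ℝ) 1 := by
  refine ⟨fun h1 => ?_, param_mem_relint hh⟩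
  have := coord_mem_ball (F := G) (hk := hk) hh h1
  rwa [coord_param hh hy] at this

/-- The characteristic map sends the unit sphere into the union of the boundary faces.
[folklore] -/
theorem param_mem_carrier_bdFace_of_mem_sphere (hh : 0 < h) {k : ℕ} (hk : G.S.card = k)
    {y : Fin k → ℝ} (hy : y ∈ sphere (0 : Fin k → ℝ) 1) :
    ∃ i₀ ∈ G.S, ∃ up : Bool, G.param h hk y ∈ (G.bdFace i₀ up).carrier h := by
  obtain ⟨j₀, hj₀⟩ := exists_abs_eq_one_of_mem_sphere hy
  refine ⟨(G.S.orderIsoOfFin hk j₀ : Fin N), (G.S.orderIsoOfFin hk j₀).2, ?_⟩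
  rcases hj₀ with h1 | h1
  · exact ⟨true, param_mem_carrier_bdFace_true hh h1⟩
  · exact ⟨false, param_mem_carrier_bdFace_false hh h1⟩

/-! ### Corners and vertices -/

variable (G) (h)

/-- The corner point `(aᵢ h)ᵢ` of a face. [folklore] -/
def cornerPoint : Fin N → ℝ := fun i => (G.a i : ℝ) * h

/-- The corner vertex of a face, as a `0`-dimensional face. [folklore] -/
def corner : Face N := ⟨G.a, ∅⟩

variable {G h}

/-- The corner point lies in the face (for `h ≥ 0`). [folklore] -/
theorem cornerPoint_mem_carrier (hh : 0 ≤ h) : G.cornerPoint h ∈ G.carrier h := fun i =>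
  ⟨fun _ => ⟨le_rfl, by unfold cornerPoint; nlinarith⟩, fun _ => rfl⟩

/-- The corner vertex of a face of the cube `b` is a face of the cube `b`. [folklore] -/
theorem corner_isFaceOf {b : Fin N → ℤ} (hG : G.IsFaceOf b) : (G.corner).IsFaceOf b := by
  intro i
  refine ⟨fun hi => absurd hi (Finset.notMem_empty i), fun _ => ?_⟩
  show G.a i = b i ∨ G.a i = b i + 1
  by_cases hiS : i ∈ G.S
  · exact Or.inl ((hG i).1 hiS)
  · exact (hG i).2 hiS

/-- The corner of the corner vertex. [folklore] -/
@[simp]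
theorem corner_a : (G.corner).a = G.a := rfl

/-- The corner vertex has no free direction. [folklore] -/
@[simp]
theorem corner_S : (G.corner).S = ∅ := rfl

/-- The corner point of the corner vertex is the corner point. [folklore] -/
@[simp]
theorem cornerPoint_corner : (G.corner).cornerPoint h = G.cornerPoint h := rfl

/-- **A vertex is a point**: a face without free directions is its corner point. [folklore] -/
theorem carrier_eq_singleton_of_S_eq_empty (hS : G.S = ∅) : G.carrier h = {G.cornerPoint h} := by
  ext y
  simp only [mem_singleton_iff]
  constructor
  · intro hy
    funext i
    exact (hy i).2 (by rw [hS]; exact Finset.notMem_empty i)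
  · rintro rfl
    intro i
    exact ⟨fun hi => absurd (hS ▸ hi) (Finset.notMem_empty i), fun _ => rfl⟩

/-- The relative interior of a vertex is the vertex. [folklore] -/
theorem relint_eq_singleton_of_S_eq_empty (hS : G.S = ∅) : G.relint h = {G.cornerPoint h} := by
  ext y
  simp only [mem_singleton_iff]
  constructor
  · intro hy
    funext i
    exact (hy i).2 (by rw [hS]; exact Finset.notMem_empty i)
  · rintro rfl
    intro i
    exact ⟨fun hi => absurd (hS ▸ hi) (Finset.notMem_empty i), fun _ => rfl⟩

/-- The corner point of the lower boundary face is the corner point. [folklore] -/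
theorem cornerPoint_bdFace_false (i₀ : Fin N) : (G.bdFace i₀ false).cornerPoint h = G.cornerPoint h := by
  funext i
  simp [cornerPoint, bdFace]

/-- The corner point of the upper boundary face differs by `h` in one coordinate. [folklore] -/
theorem cornerPoint_bdFace_true (i₀ : Fin N) :
    (G.bdFace i₀ true).cornerPoint h = Function.update (G.cornerPoint h) i₀ (((G.a i₀ : ℝ) + 1) * h) := by
  funext i
  by_cases hii : i = i₀
  · subst hii
    simp [cornerPoint, bdFace_a_self_true]
  · simp [cornerPoint, bdFace_a_of_ne G true hii, Function.update_of_ne hii]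

/-- **Corners of a face and of its boundary faces are `≤ h` apart** (sup norm, `h ≥ 0`).
[folklore] -/
theorem dist_cornerPoint_bdFace_le (hh : 0 ≤ h) (i₀ : Fin N) (up : Bool) :
    dist ((G.bdFace i₀ up).cornerPoint h) (G.cornerPoint h) ≤ h := by
  cases up
  · rw [cornerPoint_bdFace_false, dist_self]; exact hh
  · rw [cornerPoint_bdFace_true, dist_pi_le_iff hh]
    intro i
    by_cases hii : i = i₀
    · subst hii
      rw [Function.update_self, cornerPoint, Real.dist_eq]
      rw [show ((G.a i : ℝ) + 1) * h - (G.a i : ℝ) * h = h by ring, abs_of_nonneg hh]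
    · rw [Function.update_of_ne hii, dist_self]; exact hh

/-- Two points of one closed face are at sup-distance `≤ h` (`h ≥ 0`). [folklore] -/
theorem dist_le_of_mem_carrier (hh : 0 ≤ h) {x y : Fin N → ℝ} (hx : x ∈ G.carrier h)
    (hy : y ∈ G.carrier h) : dist x y ≤ h := by
  rw [dist_pi_le_iff hh]
  intro i
  rw [Real.dist_eq, abs_le]
  by_cases hi : i ∈ G.S
  · have h1 := (hx i).1 hi; have h2 := (hy i).1 hi
    constructor <;> nlinarith [h1.1, h1.2, h2.1, h2.2]
  · rw [(hx i).2 hi, (hy i).2 hi, sub_self]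
    exact ⟨by linarith, hh⟩

/-- The corner point of a face is within `h` of each of its points. [folklore] -/
theorem dist_cornerPoint_le (hh : 0 ≤ h) {y : Fin N → ℝ} (hy : y ∈ G.carrier h) :
    dist (G.cornerPoint h) y ≤ h :=
  dist_le_of_mem_carrier hh (cornerPoint_mem_carrier hh) hy

end Face

/-! ### Faces of a finite cube complex -/

variable {N : ℕ} {h : ℝ} {𝒬 : Finset (Fin N → ℤ)}

/-- Boundary faces of faces of `𝒬` are faces of `𝒬`. [folklore] -/
theorem bdFace_mem_faces {G : Face N} (hG : G ∈ faces 𝒬) {i₀ : Fin N} (hi₀ : i₀ ∈ G.S) (up : Bool) :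
    G.bdFace i₀ up ∈ faces 𝒬 := by
  obtain ⟨b, hb, hGb⟩ := hG
  exact ⟨b, hb, Face.bdFace_isFaceOf hGb hi₀ up⟩

/-- The face through a point of a face of `𝒬` is a face of `𝒬`. [folklore] -/
theorem relintFace_mem_faces {G : Face N} (hG : G ∈ faces 𝒬) (y : Fin N → ℝ) :
    G.relintFace h y ∈ faces 𝒬 := by
  obtain ⟨b, hb, hGb⟩ := hG
  exact ⟨b, hb, Face.relintFace_isFaceOf hGb y⟩

/-- Corner vertices of faces of `𝒬` are faces of `𝒬`. [folklore] -/
theorem corner_mem_faces {G : Face N} (hG : G ∈ faces 𝒬) : G.corner ∈ faces 𝒬 := by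
  obtain ⟨b, hb, hGb⟩ := hG
  exact ⟨b, hb, Face.corner_isFaceOf hGb⟩

/-- **Every point of the complex lies in the relative interior of a unique face of `𝒬`**
(existence; uniqueness is `Face.eq_of_mem_relint`). [folklore] -/
theorem exists_mem_relint_of_mem_complex {y : Fin N → ℝ} (hy : y ∈ complex 𝒬 h) :
    ∃ G ∈ faces 𝒬, y ∈ G.relint h := by
  obtain ⟨b, hb, hyb⟩ := mem_complex.1 hy
  exact ⟨(Face.top N b).relintFace h y, ⟨b, hb, Face.relintFace_isFaceOf (Face.top_isFaceOf b) y⟩,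
    Face.mem_relint_relintFace hyb⟩

/-- The dimension of a face of `𝒬` is at most `N`. [folklore] -/
theorem card_S_le (G : Face N) : G.S.card ≤ N := by
  simpa only [Fintype.card_fin] using Finset.card_le_univ G.S

end LatticeCube

end Literature.Topology.Euclidean

end
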